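import Literature.NumberTheory.LFunctions.ConreyIwaniec2002LPointwise
import HarnessLib

/-!
# Conrey–Iwaniec (2002), Proposition 9.1 for ARBITRARY companions in the range of the mean squares

B. Conrey, H. Iwaniec, *Spacing of zeros of Hecke L-functions and the class number problem*,
Acta Arith. 103 (2002), §§7–9 [held text `paper:arxiv-math_0111012`, p0017–p0020]: Proposition 9.1
(9.7) bounds `E(T) = Σ_s |ℓ(s)M̄(s) − x(s)|` over `1`-spaced `s = ½ + it`, `T < t ≤ 2T`, where "to
each point `s_r` we associate a point `s′_r = ½ + it′_r`" (8.4) — NO condition on the companion.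
The tree holds (9.7) from Proposition 6.4 (binder `h64`) for companions `|t′ − t| ≤ T/4` in the range
`2q^66 ≤ T`, `2e^{(log q)²} ≤ T` (`prop91_far_of_proposition64`), and for arbitrary companions in the
smaller range `2q^68 ≤ T`, `2q²e^{(log q)²} ≤ T` (`prop91_of_proposition64`, through a one-point
mean square at the height of the companion).

THIS FILE shows that a REMOTE companion (`|t′ − t| > T/4`) costs nothing beyond CONVEXITY: the
summand `|ℓ(s)M̄(s) − x(s)| ≤ (|L(s)| + |L(s′)|)|M(s)|/|t − t′| + 2/|t − t′|` carries the weight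
`|t − t′|^{-1} < 4/T`, and the convexity-strength bounds of `ConreyIwaniec2002LPointwise`
(`norm_afeA_sq_le_conv`: `|A(½+iu)|² ≪ Q|½+iu|·log⁵`; `norm_le_crude`: `|L(½+iu)| ≤ 2qe⁴(|u|+3)³`)
give `|L(½+iu,ψ)|² ≤ C·|u − t|²` for EVERY real `u` with `|u − t| > T/4`, `T < t ≤ 2T`, as soon as
`q⁴ ≤ T` (`norm_sq_le_sq_dist_of_remote` — no mean value, no hypothesis). Consequently
(`prop91_unrestricted_of_proposition64`) Proposition 9.1 (9.7) holds VERBATIM for an ARBITRARY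
companion map `t′ : ℝ → ℝ` in the SAME range as the far-companion theorem, `2q^66 ≤ T`,
`2e^{(log q)²} ≤ T`, modulo the typed Proposition 6.4 only; the factor `2` is the window `(T/2, T]`
of the maximisers of companions below `T` (the discrete mean square of `L` exists for windows
`(T′, 2T′]` with `q^66 ≤ T′`, `e^{(log q)²} ≤ T′`: `sum_norm_classGroupLFunction_sq_le`).

On the I6 binder `stub_prop91_large` (`q^65 ≤ T`, `e^{(log q)²} ≤ T`, `t′` arbitrary): its range
constant is NOT reachable from the typed Proposition 6.4 (`q^65 ≤ T`, window `[T, 2T]`) by the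
printed argument — the passage from the discrete mean value to the integral (Proposition 5.4,
`WeightedMeanValue.weighted_discreteMeanValue_integral`) needs the integral on `[T/2, 3T]`, i.e.
Proposition 6.4 at `T/2` (`integral_three_windows_le`: `2q^65 ≤ T`), and points of `S` just above
`T` genuinely require `L`-data just below `T`. The binder and this theorem differ by range
constants only; the one consumer (Proposition 9.2) is insensitive to them
(`proposition92_of_proposition64`). No definition, no named fact.

«The programme SEARCHES and TYPES; no claim about Landau–Siegel zeros, Theorems 1–2 of
arXiv:2211.02515 or a repaired Margin232 until a kernel theorem says so.»

## References
* [ConreyIwaniec2002] B. Conrey, H. Iwaniec, Acta Arith. 103 (2002) 259–312, arXiv:math/0111012: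
  Proposition 7.1 (7.12), Lemma 7.2 (7.16), (7.19)–(7.20), (7.26), §8 (8.1)–(8.4), (8.10),
  Proposition 9.1 (9.6)–(9.7).
* [Rademacher1959] H. Rademacher, Math. Z. 72 (1959), Theorem 4.
-/

noncomputable section

open scoped NumberField ComplexConjugate
open Complex

namespace Literature.NumberTheory.LFunctions

namespace ConreyIwaniec2002

open NumberField

/-! ### §1. Elementary inequalities -/

/-- `(2a + M)² ≤ 8a² + 2M²`; private plumbing. [folklore] -/
private theorem sq_two_mul_add_le_eight (a M : ℝ) : (2 * a + M) ^ 2 ≤ 8 * a ^ 2 + 2 * M ^ 2 := by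
  nlinarith [sq_nonneg (2 * a - M)]

/-- `e⁴ < 55`; private plumbing. [folklore] -/
private theorem exp_four_lt_55 : Real.exp 4 < 55 := by
  have h1 := Real.exp_one_lt_d9
  have h0 : 0 < Real.exp 1 := Real.exp_pos 1
  have e4 : Real.exp 4 = Real.exp 1 ^ 4 := by rw [Real.exp_one_pow]; norm_num
  rw [e4]
  calc Real.exp 1 ^ 4 < (2.7182818286 : ℝ) ^ 4 := pow_lt_pow_left₀ h1 h0.le (by norm_num)
    _ < 55 := by norm_num

/-- `Q = √q/2π ≤ q` for `q ≥ 1`; private plumbing. [cite: ConreyIwaniec2002, §7 (7.6)] -/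
private theorem condQ_le_self {q : ℕ} (hq : (1 : ℝ) ≤ q) : condQ q ≤ q := by
  unfold condQ
  have hq0 : (0 : ℝ) ≤ q := by linarith
  have hpi : (1 : ℝ) ≤ 2 * Real.pi := by linarith [Real.pi_gt_three]
  have hsq : Real.sqrt q ≤ q := by
    rw [Real.sqrt_le_left hq0]
    nlinarith
  calc Real.sqrt q / (2 * Real.pi) ≤ Real.sqrt q / 1 :=
      div_le_div_of_nonneg_left (Real.sqrt_nonneg _) one_pos hpi
    _ ≤ q := by rw [div_one]; exact hsq

/-! ### §2. A remote companion costs only convexity -/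

/-- **THE POINTWISE BOUND AT A REMOTE COMPANION, BY CONVEXITY ALONE.** For `q > 4`, `K = ℚ(√−q)`,
`ψ ∈ Ĉℓ(K)`, `q⁴ ≤ T`, `T < t ≤ 2T` and ANY real `u` with `|u − t| > T/4`:
`|L(½+iu,ψ)|² ≤ C·|u − t|²` with an absolute `C`. For `|u| < q + 5` this is Rademacher's uniform
bound `|L(½+iu)| ≤ 2qe⁴(|u|+3)³ ≤ 2970q⁴ ≤ 2970·T` (`norm_le_crude`); for `|u| ≥ q + 5` the
approximate functional equation (7.12) with `|X| = 1`, `|R| ≤ M` and the convexity-strength bound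
`|A(½+iu)|² ≤ C_A·Y₂(1+log Y₂)⁴(3+log Y₂)`, `Y₂ = Q|½+iu| + 2 ≤ qZ`, `Z = |u| + T ≤ 13|u − t|`
(`norm_afeA_sq_le_conv`), where `q ≤ Z^{1/4}` and `log Z ≤ 8(Z^{1/8} − 1)` give
`Y₂(1+log Y₂)⁴(3+log Y₂) ≤ 10⁵ Z^{15/8} ≤ 10⁵ Z²`. No mean value and no hypothesis is used.
[cite: ConreyIwaniec2002, Proposition 7.1 (7.12), Lemma 7.2 (7.16), (7.26)] -/
theorem norm_sq_le_sq_dist_of_remote :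
    ∃ C : ℝ, 0 < C ∧
    ∀ (q : ℕ) [NeZero q], 4 < q → ∀ χ : DirichletCharacter ℂ q,
      χ.IsPrimitive → χ.IsQuadratic → χ.Odd →
        ∀ (K : Type) [Field K] [NumberField K],
          Module.finrank ℚ K = 2 → NumberField.discr K = -(q : ℤ) →
            ∀ (ψ : ClassGroup (𝓞 K) →* ℂˣ) (T t u : ℝ),
              (q : ℝ) ^ (4 : ℕ) ≤ T → T < t → t ≤ 2 * T → T / 4 < |u - t| →
                ‖classGroupLFunction K ψ (1 / 2 + u * I)‖ ^ 2 ≤ C * (u - t) ^ 2 := by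
  obtain ⟨CA, hCA, hA⟩ := norm_afeA_sq_le_conv
  obtain ⟨M, hM, hR⟩ := norm_afeR_half_le
  refine ⟨169 * (8 * 10 ^ 5 * CA + 2 * M ^ 2) + 16 * 2970 ^ 2, by positivity,
    fun q _ hq χ hprim hquad hoddχ K _ _ h2 hdisc ψ T t u hT hTt ht2 hut => ?_⟩
  have hq0 : 0 < q := by omega
  have hq5 : (5 : ℝ) ≤ q := by exact_mod_cast hq
  have hq1 : (1 : ℝ) ≤ q := by linarith
  have hqpos : (0 : ℝ) < q := by linarith
  have h54 : (5 : ℝ) ^ (4 : ℕ) ≤ (q : ℝ) ^ (4 : ℕ) := pow_le_pow_left₀ (by norm_num) hq5 4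
  have hT625 : (625 : ℝ) ≤ T := by norm_num at h54; linarith
  have hT0 : 0 < T := by linarith
  have ht0 : 0 < t := by linarith
  have hK1 : 0 ≤ 169 * (8 * 10 ^ 5 * CA + 2 * M ^ 2) := by positivity
  have hK2 : 0 ≤ 16 * (2970 : ℝ) ^ 2 := by positivity
  have hd2 : 0 ≤ (u - t) ^ 2 := sq_nonneg _
  -- `T² ≤ 16 (u − t)²`
  have hT16 : T ^ 2 ≤ 16 * (u - t) ^ 2 := by
    have h1 : (T / 4) ^ 2 < |u - t| ^ 2 := pow_lt_pow_left₀ hut (by positivity) two_ne_zero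
    rw [sq_abs] at h1
    nlinarith
  have hL0 : 0 ≤ ‖classGroupLFunction K ψ (1 / 2 + u * I)‖ := norm_nonneg _
  by_cases hsmall : |u| < q + 5
  · -- Rademacher's uniform convexity bound
    have hcr := norm_le_crude K h2 hdisc ψ u
    have hu3 : |u| + 3 ≤ 3 * q := by linarith
    have hL1 : ‖classGroupLFunction K ψ (1 / 2 + u * I)‖ ≤ 2970 * (q : ℝ) ^ (4 : ℕ) := by
      calc ‖classGroupLFunction K ψ (1 / 2 + u * I)‖ ≤ 2 * q * Real.exp 4 * (|u| + 3) ^ 3 := hcr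
        _ ≤ 2 * q * 55 * (3 * q) ^ 3 :=
            mul_le_mul (mul_le_mul_of_nonneg_left exp_four_lt_55.le (by positivity))
              (pow_le_pow_left₀ (by positivity) hu3 3) (by positivity) (by positivity)
        _ = 2970 * (q : ℝ) ^ (4 : ℕ) := by ring
    have hq8 : ((q : ℝ) ^ (4 : ℕ)) ^ 2 ≤ T ^ 2 := pow_le_pow_left₀ (by positivity) hT 2
    calc ‖classGroupLFunction K ψ (1 / 2 + u * I)‖ ^ 2 ≤ (2970 * (q : ℝ) ^ (4 : ℕ)) ^ 2 :=
          pow_le_pow_left₀ hL0 hL1 2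
      _ = 2970 ^ 2 * ((q : ℝ) ^ (4 : ℕ)) ^ 2 := by ring
      _ ≤ 2970 ^ 2 * T ^ 2 := by gcongr
      _ ≤ 2970 ^ 2 * (16 * (u - t) ^ 2) := by gcongr
      _ = 16 * 2970 ^ 2 * (u - t) ^ 2 := by ring
      _ ≤ (169 * (8 * 10 ^ 5 * CA + 2 * M ^ 2) + 16 * 2970 ^ 2) * (u - t) ^ 2 := by
          nlinarith [mul_nonneg hK1 hd2]
  · -- the approximate functional equation at convexity strength
    push Not at hsmall
    have hu1 : 1 ≤ |u| := by linarith
    have hu4 : 4 ≤ |u| := by linarith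
    have huq : (q : ℝ) + 1 ≤ |u| := by linarith
    have hAu := hA q hq χ hprim hquad hoddχ K h2 hdisc ψ u hu1
    have hRu := hR q hq0 K h2 hdisc ψ u huq hu4
    have hLu := norm_classGroupLFunction_le_afe hq0 K h2 hdisc ψ u
    set w : ℂ := 1 / 2 + u * I with hw
    set Y₂ : ℝ := condQ q * ‖w‖ + 2 with hY₂
    -- the height parameter `Z = |u| + T` and its eighth root `W`
    set Z : ℝ := |u| + T with hZ
    have hZT : T ≤ Z := by rw [hZ]; linarith [abs_nonneg u]
    have hZ1 : 1 ≤ Z := by linarith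
    have hZ0 : 0 < Z := by linarith
    set W : ℝ := Real.sqrt (Real.sqrt (Real.sqrt Z)) with hW
    have hW1 : 1 ≤ W :=
      Real.one_le_sqrt.2 (Real.one_le_sqrt.2 (Real.one_le_sqrt.2 hZ1))
    have hW0 : 0 < W := by linarith
    have hW8 : W ^ 8 = Z := by
      have h1 : W ^ 2 = Real.sqrt (Real.sqrt Z) := Real.sq_sqrt (Real.sqrt_nonneg _)
      have h2' : Real.sqrt (Real.sqrt Z) ^ 2 = Real.sqrt Z := Real.sq_sqrt (Real.sqrt_nonneg _)
      have h3 : Real.sqrt Z ^ 2 = Z := Real.sq_sqrt hZ0.le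
      calc W ^ 8 = ((W ^ 2) ^ 2) ^ 2 := by ring
        _ = Z := by rw [h1, h2', h3]
    have hlogW : Real.log W ≤ W - 1 := Real.log_le_sub_one_of_pos hW0
    -- `q ≤ W²` from `q⁴ ≤ T ≤ Z = (W²)⁴`
    have hqW : (q : ℝ) ≤ W ^ 2 := by
      have h : (q : ℝ) ^ (4 : ℕ) ≤ (W ^ 2) ^ (4 : ℕ) := by
        calc (q : ℝ) ^ (4 : ℕ) ≤ T := hT
          _ ≤ Z := hZT
          _ = (W ^ 2) ^ (4 : ℕ) := by rw [← hW8]; ring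
      exact (pow_le_pow_iff_left₀ hqpos.le (by positivity) (by norm_num)).mp h
    -- `Y₂ ≤ qZ ≤ W^{10}`
    have hQ : condQ q ≤ q := condQ_le_self hq1
    have hwn : ‖w‖ ≤ |u| + 1 := by
      calc ‖w‖ ≤ ‖(1 / 2 : ℂ)‖ + ‖(u : ℂ) * I‖ := norm_add_le _ _
        _ = 1 / 2 + |u| := by
            rw [norm_mul, Complex.norm_I, mul_one, Complex.norm_real, Real.norm_eq_abs]
            norm_num
        _ ≤ |u| + 1 := by linarith
    have hY₂W : Y₂ ≤ W ^ 10 := by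
      have h1 : condQ q * ‖w‖ ≤ q * (|u| + 1) := mul_le_mul hQ hwn (norm_nonneg _) hqpos.le
      have hqT : (q : ℝ) * 625 ≤ q * T := mul_le_mul_of_nonneg_left hT625 hqpos.le
      have h2' : (q : ℝ) * (|u| + 1) + 2 ≤ q * Z := by
        rw [hZ, mul_add, mul_add]
        linarith
      have h3 : (q : ℝ) * Z ≤ W ^ 2 * W ^ 8 := by
        rw [hW8]; exact mul_le_mul_of_nonneg_right hqW hZ0.le
      calc Y₂ = condQ q * ‖w‖ + 2 := rfl
        _ ≤ q * (|u| + 1) + 2 := by linarith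
        _ ≤ q * Z := h2'
        _ ≤ W ^ 2 * W ^ 8 := h3
        _ = W ^ 10 := by ring
    have hY₂2 : 2 ≤ Y₂ := by
      have : 0 ≤ condQ q * ‖w‖ := mul_nonneg (condQ_pos hq0).le (norm_nonneg _)
      rw [hY₂]; linarith
    have hY₂pos : 0 < Y₂ := by linarith
    have hlogY₂ : Real.log Y₂ ≤ 10 * (W - 1) := by
      calc Real.log Y₂ ≤ Real.log (W ^ 10) := Real.log_le_log hY₂pos hY₂W
        _ = 10 * Real.log W := by rw [Real.log_pow]; norm_num
        _ ≤ 10 * (W - 1) := by linarith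
    have hlogY₂0 : 0 ≤ Real.log Y₂ := Real.log_nonneg (by linarith)
    have h1l : 1 + Real.log Y₂ ≤ 10 * W := by linarith
    have h1l0 : 0 ≤ 1 + Real.log Y₂ := by linarith
    have h3l : 3 + Real.log Y₂ ≤ 10 * W := by linarith
    have h3l0 : 0 ≤ 3 + Real.log Y₂ := by linarith
    -- `|A|² ≤ 10⁵ C_A Z²`
    have hA2 : ‖afeA K ψ q w‖ ^ 2 ≤ 10 ^ 5 * CA * Z ^ 2 := by
      have s1 : (1 + Real.log Y₂) ^ 4 ≤ (10 * W) ^ 4 := pow_le_pow_left₀ h1l0 h1l 4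
      have hW15 : W ^ 15 ≤ W ^ 16 := pow_le_pow_right₀ hW1 (by norm_num)
      calc ‖afeA K ψ q w‖ ^ 2 ≤ CA * Y₂ * (1 + Real.log Y₂) ^ 4 * (3 + Real.log Y₂) := hAu
        _ ≤ CA * W ^ 10 * (10 * W) ^ 4 * (10 * W) :=
            mul_le_mul (mul_le_mul (mul_le_mul_of_nonneg_left hY₂W hCA.le) s1
              (by positivity) (by positivity)) h3l h3l0 (by positivity)
        _ = 10 ^ 5 * CA * W ^ 15 := by ring
        _ ≤ 10 ^ 5 * CA * W ^ 16 := by gcongr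
        _ = 10 ^ 5 * CA * Z ^ 2 := by rw [← hW8]; ring
    -- `Z ≤ 13 |u − t|`
    have hZd : Z ≤ 13 * |u - t| := by
      have h1 := abs_sub_abs_le_abs_sub u t
      rw [abs_of_pos ht0] at h1
      rw [hZ]; linarith
    have hZ2 : Z ^ 2 ≤ 169 * (u - t) ^ 2 := by
      have := pow_le_pow_left₀ hZ0.le hZd 2
      rw [mul_pow, sq_abs] at this
      linarith
    have hLle : ‖classGroupLFunction K ψ w‖ ≤ 2 * ‖afeA K ψ q w‖ + M := by linarith
    calc ‖classGroupLFunction K ψ w‖ ^ 2 ≤ (2 * ‖afeA K ψ q w‖ + M) ^ 2 :=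
          pow_le_pow_left₀ hL0 hLle 2
      _ ≤ 8 * ‖afeA K ψ q w‖ ^ 2 + 2 * M ^ 2 := sq_two_mul_add_le_eight _ _
      _ ≤ 8 * (10 ^ 5 * CA * Z ^ 2) + 2 * M ^ 2 * Z ^ 2 := by
          have hM2 : 0 ≤ 2 * M ^ 2 := by positivity
          have hZsq1 : 1 ≤ Z ^ 2 := one_le_pow₀ hZ1
          linarith [mul_le_mul_of_nonneg_left hZsq1 hM2]
      _ = (8 * 10 ^ 5 * CA + 2 * M ^ 2) * Z ^ 2 := by ring
      _ ≤ (8 * 10 ^ 5 * CA + 2 * M ^ 2) * (169 * (u - t) ^ 2) :=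
          mul_le_mul_of_nonneg_left hZ2 (by positivity)
      _ = 169 * (8 * 10 ^ 5 * CA + 2 * M ^ 2) * (u - t) ^ 2 := by ring
      _ ≤ (169 * (8 * 10 ^ 5 * CA + 2 * M ^ 2) + 16 * 2970 ^ 2) * (u - t) ^ 2 := by
          nlinarith [mul_nonneg hK2 hd2]

/-! ### §3. Cauchy–Schwarz -/

/-- `Σ f g ≤ (Σ f²)^{1/2} (Σ g²)^{1/2}` (Cauchy–Schwarz, private plumbing). [folklore] -/
private theorem sum_mul_le_sqrt_mul_sqrt_cs {ι : Type*} (s : Finset ι) (f g : ι → ℝ) :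
    ∑ i ∈ s, f i * g i ≤ Real.sqrt (∑ i ∈ s, f i ^ 2) * Real.sqrt (∑ i ∈ s, g i ^ 2) := by
  rw [← Real.sqrt_mul (Finset.sum_nonneg fun i _ => sq_nonneg (f i))]
  exact (le_abs_self _).trans (Real.abs_le_sqrt (Finset.sum_mul_sq_le_sq_mul_sq s f g))

/-! ### §4. Proposition 9.1 for arbitrary companions, in the range of the far-companion theorem -/

/-- **CI PROPOSITION 9.1 (9.7) FOR ARBITRARY COMPANIONS, FROM PROPOSITION 6.4, IN THE RANGE
`2q^66 ≤ T`, `2e^{(log q)²} ≤ T`.** For `q` odd `> 4`, `K = ℚ(√−q)`, `ψ ∈ Ĉℓ(K)`, a `1`-spaced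
`S ⊂ (T, 2T]` and ANY companion map `t′ : ℝ → ℝ` (the printed (8.4)):
`E(T) = Σ_{t∈S}|ℓ(s)M̄(s) − x(s)| ≤ C·(T(log q)^6 + Tℒ(T)^{1/2}(log T)²(log q)^{5/2})` — the
conclusion VERBATIM that of the I6 binder `stub_prop91_large`, the range that of
`prop91_far_of_proposition64` (companions within `T/4`), which handles the points whose companion is
within `T/4`; the remaining points cost `(4/T)Σ|L(s)||M(s)| + Σ|L(s′)||M(s)|/|t−t′| + 8#S/T`, bounded
by Cauchy from the mean squares `Σ|L(s)|² ≪ T(log q)^7 + Tℒ(T)(log T)^4`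
(`sum_norm_classGroupLFunction_sq_le`), `Σ|M(s)|² ≪ T(log q)^5` (`sum_norm_shortInvSum_sq_le`) and
the pointwise `|L(s′)|²/|t−t′|² ≤ C` of `norm_sq_le_sq_dist_of_remote` (convexity only). Supersedes
the range `2q^68 ≤ T`, `2q²e^{(log q)²} ≤ T` of `prop91_of_proposition64`.
[cite: ConreyIwaniec2002, Proposition 9.1 (9.7)] -/
theorem prop91_unrestricted_of_proposition64 (h64 : conreyIwaniec2002_proposition64) :
    ∃ C : ℝ, 0 < C ∧
    ∀ (q : ℕ) [NeZero q], 4 < q → Odd q → ∀ χ : DirichletCharacter ℂ q,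
      χ.IsPrimitive → χ.IsQuadratic → χ.Odd →
        ∀ (K : Type) [Field K] [NumberField K],
          Module.finrank ℚ K = 2 → NumberField.discr K = -(q : ℤ) →
            ∀ (ψ : ClassGroup (𝓞 K) →* ℂˣ) (T : ℝ) (S : Finset ℝ) (t' : ℝ → ℝ),
              2 * (q : ℝ) ^ (66 : ℕ) ≤ T → 2 * Real.exp (Real.log q ^ (2 : ℕ)) ≤ T →
                IsDyadicPointSet S T →
                defectE K ψ q S t' ≤
                  C * (T * Real.log q ^ (6 : ℕ) +
                    T * Real.sqrt (calL χ T) * Real.log T ^ (2 : ℕ) * Real.log q ^ ((5 : ℝ) / 2)) := by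
  obtain ⟨CB, hCB, hB⟩ := prop91_far_of_proposition64 h64
  obtain ⟨CL, hCL, hL⟩ := sum_norm_classGroupLFunction_sq_le h64
  obtain ⟨C₂, hC₂, hM⟩ := sum_norm_shortInvSum_sq_le
  obtain ⟨Kc, hKc, hrem⟩ := norm_sq_le_sq_dist_of_remote
  refine ⟨CB + Real.sqrt (CL * C₂) + Real.sqrt (2 * Kc * C₂) + 1, by positivity,
    fun q _ hq hodd χ hprim hquad hoddχ K _ _ h2 hdisc ψ T S t' hT hexpT hS => ?_⟩
  classical
  -- numerics
  have hq0 : 0 < q := by omega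
  have hq5 : (5 : ℝ) ≤ q := by exact_mod_cast hq
  have hq1 : (1 : ℝ) ≤ q := by linarith
  have hqpos : (0 : ℝ) < q := by linarith
  have hexp0 := Real.exp_pos (Real.log q ^ (2 : ℕ))
  have hq66_0 : 0 ≤ (q : ℝ) ^ (66 : ℕ) := by positivity
  have hq66 : (q : ℝ) ^ (66 : ℕ) ≤ T := by linarith
  have hexp1 : Real.exp (Real.log q ^ (2 : ℕ)) ≤ T := by linarith
  obtain ⟨hℓ1, hℓLT, hLT1, -, hq41, -, hT3, -⟩ := prop81_numerics hq hq66 hexp1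
  have hT0 : 0 < T := by linarith
  have h625 : (5 : ℝ) ^ (4 : ℕ) ≤ (q : ℝ) ^ (4 : ℕ) := pow_le_pow_left₀ (by norm_num) hq5 4
  have hq4cast : ((q ^ 4 : ℕ) : ℝ) = (q : ℝ) ^ (4 : ℕ) := by push_cast; ring
  have hT4 : (626 : ℝ) ≤ T := by norm_num at h625; linarith
  have hq4T : (q : ℝ) ^ (4 : ℕ) ≤ T := by linarith
  have hT2 : (2 : ℝ) ≤ T := by linarith
  set ℓ : ℝ := Real.log q with hℓ
  set LT : ℝ := Real.log T with hLT
  set cLT : ℝ := calL χ T with hcLT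
  have hℓ0 : 0 ≤ ℓ := by linarith
  have hcLT0 : 0 ≤ cLT := calL_nonneg χ (by linarith)
  set X : ℝ := T * ℓ ^ (7 : ℕ) + T * cLT * LT ^ (4 : ℕ) with hX
  set Y : ℝ := T * ℓ ^ (6 : ℕ) + T * Real.sqrt cLT * LT ^ (2 : ℕ) * ℓ ^ ((5 : ℝ) / 2) with hY
  have hX0 : 0 ≤ X := by positivity
  have hY0 : 0 ≤ Y := by positivity
  have hTX : T ≤ X := by
    have h7 : (1 : ℝ) ≤ ℓ ^ (7 : ℕ) := one_le_pow₀ hℓ1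
    have h8 : T ≤ T * ℓ ^ (7 : ℕ) := le_mul_of_one_le_right hT0.le h7
    have : 0 ≤ T * cLT * LT ^ (4 : ℕ) := by positivity
    rw [hX]; linarith
  have hTY : T ≤ Y := by
    have h6 : (1 : ℝ) ≤ ℓ ^ (6 : ℕ) := one_le_pow₀ hℓ1
    have h8 : T ≤ T * ℓ ^ (6 : ℕ) := le_mul_of_one_le_right hT0.le h6
    have : 0 ≤ T * Real.sqrt cLT * LT ^ (2 : ℕ) * ℓ ^ ((5 : ℝ) / 2) := by positivity
    rw [hY]; linarith
  have hcard : (S.card : ℝ) ≤ 2 * T := (hS.isPointSet hT2).card_le' (by linarith)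
  -- split `S` by the distance of the companion
  set Sm := S.filter (fun t => |t' t - t| ≤ T / 4) with hSm
  set Sr := S.filter (fun t => ¬ |t' t - t| ≤ T / 4) with hSr
  have hsplit : defectE K ψ q S t' = defectE K ψ q Sm t' + defectE K ψ q Sr t' := by
    unfold defectE
    exact (Finset.sum_filter_add_sum_filter_not S _ _).symm
  have hSmS : Sm ⊆ S := Finset.filter_subset _ _
  have hSrS : Sr ⊆ S := Finset.filter_subset _ _
  have hremote : ∀ t ∈ Sr, T / 4 < |t' t - t| := fun t ht => not_le.mp (Finset.mem_filter.1 ht).2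
  -- (1) companions within `T/4`
  have hEm : defectE K ψ q Sm t' ≤ CB * Y :=
    hB q hq hodd χ hprim hquad hoddχ K h2 hdisc ψ T Sm t' hT hexpT (hS.subset hSmS)
      (fun t ht => (Finset.mem_filter.1 ht).2)
  -- (2) remote companions, pointwise
  set Lf : ℝ → ℂ := fun v => classGroupLFunction K ψ (1 / 2 + v * I) with hLf
  set Mf : ℝ → ℂ := fun v => shortInvSum K ψ q (1 / 2 + v * I) with hMf
  have hptw : ∀ t ∈ Sr,
      ‖dividedDifference (classGroupLFunction K ψ) (1 / 2 + t * I) (1 / 2 + t' t * I) *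
            starRingEnd ℂ (shortInvSum K ψ q (1 / 2 + t * I)) -
          xQuot q (1 / 2 + t * I) (1 / 2 + t' t * I)‖ ≤
        4 / T * (‖Lf t‖ * ‖Mf t‖) + ‖Lf (t' t)‖ / |t' t - t| * ‖Mf t‖ + 8 / T := by
    intro t ht
    have hd := hremote t ht
    have hne : t' t ≠ t := by
      intro e; rw [e, sub_self, abs_zero] at hd; linarith
    have hd0 : 0 < |t' t - t| := by linarith
    have hinv : 1 / |t' t - t| ≤ 4 / T := by
      rw [div_le_div_iff₀ hd0 hT0]; linarith
    have hℓ' := norm_dividedDifference_half_le (classGroupLFunction K ψ) hne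
    have hx := norm_xQuot_le_two_div hq0 hne
    have hM0 : 0 ≤ ‖Mf t‖ := norm_nonneg _
    have hL0 : 0 ≤ ‖Lf t‖ := norm_nonneg _
    have hL0' : 0 ≤ ‖Lf (t' t)‖ := norm_nonneg _
    calc ‖dividedDifference (classGroupLFunction K ψ) (1 / 2 + t * I) (1 / 2 + t' t * I) *
              starRingEnd ℂ (Mf t) - xQuot q (1 / 2 + t * I) (1 / 2 + t' t * I)‖
        ≤ ‖dividedDifference (classGroupLFunction K ψ) (1 / 2 + t * I) (1 / 2 + t' t * I) *
              starRingEnd ℂ (Mf t)‖ + ‖xQuot q (1 / 2 + t * I) (1 / 2 + t' t * I)‖ := norm_sub_le _ _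
      _ = ‖dividedDifference (classGroupLFunction K ψ) (1 / 2 + t * I) (1 / 2 + t' t * I)‖ * ‖Mf t‖ +
            ‖xQuot q (1 / 2 + t * I) (1 / 2 + t' t * I)‖ := by rw [norm_mul, RCLike.norm_conj]
      _ ≤ (‖Lf t‖ + ‖Lf (t' t)‖) / |t' t - t| * ‖Mf t‖ + 2 / |t' t - t| := by gcongr
      _ = (1 / |t' t - t|) * (‖Lf t‖ * ‖Mf t‖) + ‖Lf (t' t)‖ / |t' t - t| * ‖Mf t‖ +
            2 * (1 / |t' t - t|) := by ring
      _ ≤ 4 / T * (‖Lf t‖ * ‖Mf t‖) + ‖Lf (t' t)‖ / |t' t - t| * ‖Mf t‖ + 2 * (4 / T) := by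
          gcongr
      _ = 4 / T * (‖Lf t‖ * ‖Mf t‖) + ‖Lf (t' t)‖ / |t' t - t| * ‖Mf t‖ + 8 / T := by ring
  have hEr : defectE K ψ q Sr t' ≤
      ∑ t ∈ Sr, (4 / T * (‖Lf t‖ * ‖Mf t‖) + ‖Lf (t' t)‖ / |t' t - t| * ‖Mf t‖ + 8 / T) := by
    unfold defectE
    exact Finset.sum_le_sum hptw
  rw [Finset.sum_add_distrib, Finset.sum_add_distrib, Finset.sum_const, nsmul_eq_mul,
    ← Finset.mul_sum] at hEr
  -- the mean squares at hand
  have hD : ∑ t ∈ S, ‖Lf t‖ ^ 2 ≤ CL * (T * ℓ ^ (7 : ℕ) + T * cLT * LT ^ (4 : ℕ)) :=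
    hL q hq hodd χ hprim hquad hoddχ K h2 hdisc ψ T S hq66 hexp1 hS
  have hSM : ∑ t ∈ S, ‖Mf t‖ ^ 2 ≤ C₂ * (T * ℓ ^ (5 : ℕ)) :=
    hM q hq hodd χ hprim hquad hoddχ K h2 hdisc ψ T S hq4T hS
  have hSMr : ∑ t ∈ Sr, ‖Mf t‖ ^ 2 ≤ C₂ * (T * ℓ ^ (5 : ℕ)) :=
    (Finset.sum_le_sum_of_subset_of_nonneg hSrS fun _ _ _ => by positivity).trans hSM
  -- (2a) `(4/T) Σ |L(s)||M(s)| ≤ √(C_L C₂) Y`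
  have h2a : 4 / T * ∑ t ∈ Sr, ‖Lf t‖ * ‖Mf t‖ ≤ Real.sqrt (CL * C₂) * Y := by
    have h1 : ∑ t ∈ Sr, ‖Lf t‖ * ‖Mf t‖ ≤ Real.sqrt (CL * C₂) * Y := by
      calc ∑ t ∈ Sr, ‖Lf t‖ * ‖Mf t‖ ≤ ∑ t ∈ S, ‖Lf t‖ * ‖Mf t‖ :=
            Finset.sum_le_sum_of_subset_of_nonneg hSrS fun _ _ _ => by positivity
        _ ≤ Real.sqrt (∑ t ∈ S, ‖Lf t‖ ^ 2) * Real.sqrt (∑ t ∈ S, ‖Mf t‖ ^ 2) :=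
            sum_mul_le_sqrt_mul_sqrt_cs S _ _
        _ ≤ Real.sqrt (CL * C₂) * Y := diagonal_term_le hCL hC₂ hT0.le hℓ0 hcLT0 hD hSM
    have h4T : 4 / T ≤ 1 := by rw [div_le_one hT0]; linarith
    have h0 : 0 ≤ ∑ t ∈ Sr, ‖Lf t‖ * ‖Mf t‖ := Finset.sum_nonneg fun _ _ => by positivity
    calc 4 / T * ∑ t ∈ Sr, ‖Lf t‖ * ‖Mf t‖ ≤ 1 * ∑ t ∈ Sr, ‖Lf t‖ * ‖Mf t‖ :=
          mul_le_mul_of_nonneg_right h4T h0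
      _ ≤ Real.sqrt (CL * C₂) * Y := by rw [one_mul]; exact h1
  -- (2b) the remote companions through the pointwise convexity bound
  have hG : ∑ t ∈ Sr, (‖Lf (t' t)‖ / |t' t - t|) ^ 2 ≤
      2 * Kc * (T * ℓ ^ (7 : ℕ) + T * cLT * LT ^ (4 : ℕ)) := by
    have hpt : ∀ t ∈ Sr, (‖Lf (t' t)‖ / |t' t - t|) ^ 2 ≤ Kc := by
      intro t ht
      have hd := hremote t ht
      have htS := hS.mem_bounds (hSrS ht)
      have h := hrem q hq χ hprim hquad hoddχ K h2 hdisc ψ T t (t' t) hq4T htS.1 htS.2 hd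
      have hd0 : 0 < |t' t - t| := by linarith
      have hd2 : 0 < (t' t - t) ^ 2 := by rw [← sq_abs]; positivity
      rw [div_pow, sq_abs, div_le_iff₀ hd2]
      exact h
    have hcardr : (Sr.card : ℝ) ≤ 2 * T := by
      have : (Sr.card : ℝ) ≤ S.card := by exact_mod_cast Finset.card_le_card hSrS
      linarith
    calc ∑ t ∈ Sr, (‖Lf (t' t)‖ / |t' t - t|) ^ 2 ≤ ∑ t ∈ Sr, Kc := Finset.sum_le_sum hpt
      _ = Sr.card * Kc := by rw [Finset.sum_const, nsmul_eq_mul]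
      _ ≤ 2 * T * Kc := mul_le_mul_of_nonneg_right hcardr hKc.le
      _ = 2 * Kc * T := by ring
      _ ≤ 2 * Kc * X := mul_le_mul_of_nonneg_left hTX (by positivity)
      _ = 2 * Kc * (T * ℓ ^ (7 : ℕ) + T * cLT * LT ^ (4 : ℕ)) := by rw [hX]
  have h2b : ∑ t ∈ Sr, ‖Lf (t' t)‖ / |t' t - t| * ‖Mf t‖ ≤ Real.sqrt (2 * Kc * C₂) * Y := by
    have hK2 : 0 < 2 * Kc := by positivity
    calc ∑ t ∈ Sr, ‖Lf (t' t)‖ / |t' t - t| * ‖Mf t‖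
        ≤ Real.sqrt (∑ t ∈ Sr, (‖Lf (t' t)‖ / |t' t - t|) ^ 2) * Real.sqrt (∑ t ∈ Sr, ‖Mf t‖ ^ 2) :=
          sum_mul_le_sqrt_mul_sqrt_cs Sr _ _
      _ ≤ Real.sqrt (2 * Kc * C₂) * Y := diagonal_term_le hK2 hC₂ hT0.le hℓ0 hcLT0 hG hSMr
  -- (2c) the constant `8/T` per remote point
  have h2c : (Sr.card : ℝ) * (8 / T) ≤ Y := by
    have : (Sr.card : ℝ) ≤ S.card := by exact_mod_cast Finset.card_le_card hSrS
    have h16 : (Sr.card : ℝ) * (8 / T) ≤ 16 := by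
      rw [mul_div_assoc', div_le_iff₀ hT0]; linarith
    linarith
  -- assemble
  have hErY : defectE K ψ q Sr t' ≤ (Real.sqrt (CL * C₂) + Real.sqrt (2 * Kc * C₂) + 1) * Y := by
    have hexpand : (Real.sqrt (CL * C₂) + Real.sqrt (2 * Kc * C₂) + 1) * Y =
        Real.sqrt (CL * C₂) * Y + Real.sqrt (2 * Kc * C₂) * Y + Y := by ring
    rw [hexpand]
    linarith [hEr, h2a, h2b, h2c]
  have hcomb : (CB + Real.sqrt (CL * C₂) + Real.sqrt (2 * Kc * C₂) + 1) * Y =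
      CB * Y + (Real.sqrt (CL * C₂) + Real.sqrt (2 * Kc * C₂) + 1) * Y := by ring
  rw [hsplit, hcomb]
  exact add_le_add hEm hErY

end ConreyIwaniec2002

end Literature.NumberTheory.LFunctions

end
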